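import Literature.Analysis.Pluripotential.SubharmonicMaxPrinciple
import Literature.Analysis.Pluripotential.NonPluripolarMongeAmpereMass
import HarnessLib

/-!
# Local integrability of (pluri)subharmonic functions: circle, disc and polydisc inequalities

Topic `Literature/Analysis/Pluripotential`; step (P3) of the proof of the named fact
`BoucksomEtAl2010_regularMass_le_degree_pow` (`NonPluripolarMongeAmpereMass.lean`), for the tree's
`[-∞, +∞)`-valued notions `IsSubharmonicOn` / `IsPlurisubharmonicOn` (mean-value form, Hörmander
Def. 1.6.1 / Thm. 1.6.3 / Def. 2.6.1). Everything is stated in the `[0, ∞]`-valued form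
"`∫ u⁻ ≤ ∫ u⁺ + (u c)⁻`", which is trivially true at a pole `u c = -∞` and needs no integrability
hypotheses, and from which `L¹` statements follow at once:

* `IsSubharmonicOn.circleLowerMean_le` — on a circle: `(2π)⁻¹∫ u⁻ ≤ (2π)⁻¹∫ u⁺ + (u c)⁻`;
  `IsSubharmonicOn.circleIntegrable_toReal` — at a finite centre the real function `u.toReal`
  (junk `0` at poles) is integrable on the circle and satisfies the real mean-value inequality
  with `Real.circleAverage` (poles on the circle only raise the average);
* `IsSubharmonicOn.lintegral_closedBall_negPart_le` — on a disc (subharmonic on `ℂ`, `u ≤ M` on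
  `D̄(c, R)`): `∫_{D̄} u⁻ dλ ≤ (M⁺ + (u c)⁻) λ(D̄)`, by polar coordinates
  (`Complex.lintegral_comp_polarCoord_symm`) from the circle inequality; auxiliary
  `lintegral_Ioc_eq_of_periodic` (period integrals of periodic functions, via `AddCircle`),
  `add_polarCoord_symm_eq_circleMap`, `circleUpperMean_le_of_le`, `enorm_toReal_le`;
* `IsPlurisubharmonicOn.lintegral_closedBall_negPart_le_pi` — **on a polydisc of `ℂᵐ`**
  (psh on `ℂᵐ`, `u ≤ M` on the closed sup-norm ball `P̄(z₀, ρ)`):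
  `∫_{P̄} u⁻ dλ ≤ (m M⁺ + (u z₀)⁻) λ(P̄)`, by induction on `m` (Tonelli through
  `MeasurableEquiv.piFinSuccAbove`, slices `IsPlurisubharmonicOn.slice_cons` / `slice_first`).
  Hence a psh function finite at one point is integrable on every polydisc around it
  (the classical `PSH ⊆ L¹_{loc}`, Hörmander §2.6).

## References

* [HormanderSCV1973] L. Hörmander, An introduction to complex analysis in several variables
  (1973): Def. 1.6.1, Thm. 1.6.3 (mean-value inequalities), Def. 2.6.1 and §2.6
  (plurisubharmonic functions, local integrability). The `[0,∞]` bookkeeping is ours.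
-/

noncomputable section

open scoped Topology ENNReal
open MeasureTheory Filter Set Metric

namespace Literature.Analysis.Pluripotential

variable {u : ℂ → EReal} {U : Set ℂ} {c : ℂ} {R : ℝ}

/-- For `x ∈ [-∞, +∞]`, `‖x.toReal‖ₑ ≤ x⁺ + x⁻`. [folklore] -/
theorem enorm_toReal_le (x : EReal) : ‖x.toReal‖ₑ ≤ x.toENNReal + (-x).toENNReal := by
  induction x using EReal.rec with
  | bot => simp
  | top => simp
  | coe r =>
    rw [EReal.toReal_coe, ← EReal.coe_neg, EReal.real_coe_toENNReal, EReal.real_coe_toENNReal,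
      Real.enorm_eq_ofReal_abs]
    rcases le_total 0 r with hr | hr
    · rw [abs_of_nonneg hr, ENNReal.ofReal_of_nonpos (neg_nonpos.mpr hr), add_zero]
    · rw [abs_of_nonpos hr, ENNReal.ofReal_of_nonpos hr, zero_add]

/-- Trichotomy of `[-∞, +∞]`. [folklore] -/
theorem EReal.eq_bot_or_eq_top_or_exists_coe (x : EReal) : x = ⊥ ∨ x = ⊤ ∨ ∃ r : ℝ, x = r := by
  induction x using EReal.rec with
  | bot => exact Or.inl rfl
  | top => exact Or.inr (Or.inl rfl)
  | coe r => exact Or.inr (Or.inr ⟨r, rfl⟩)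

/-- **Circle inequality, `[0, ∞]` form**: for `u` subharmonic on `U ⊇ D̄(c, R)`, `R > 0`, the
lower circle mean is bounded by the upper one plus `(u c)⁻`:
`(2π)⁻¹ ∫ u⁻ ≤ (2π)⁻¹ ∫ u⁺ + (u c)⁻` (trivial when `u c = -∞`). [cite: HormanderSCV1973,
    Thm. 1.6.3] -/
theorem IsSubharmonicOn.circleLowerMean_le (hu : IsSubharmonicOn u U) (hR : 0 < R)
    (hcl : closedBall c R ⊆ U) :
    circleLowerMean u c R ≤ circleUpperMean u c R + (-u c).toENNReal := by
  have key := hu.le_circleMean hR hcl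
  have hU : ∀ θ : ℝ, circleMap c R θ ∈ U := fun θ ↦
    hcl (sphere_subset_closedBall (circleMap_mem_sphere c hR.le θ))
  obtain ⟨C, hC⟩ := exists_forall_comp_circleMap_le hu.upperSemicontinuousOn
    (fun z hz ↦ hu.lt_top hz) hU
  have hAtop : circleUpperMean u c R ≠ ⊤ := circleUpperMean_ne_top hC
  set A := circleUpperMean u c R with hA
  set B := circleLowerMean u c R with hB
  rcases EReal.eq_bot_or_eq_top_or_exists_coe (u c) with huc | huc | ⟨x, huc⟩
  · simp [huc]
  · exact absurd huc (hu.lt_top (hcl (mem_closedBall_self hR.le))).ne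
  · rw [huc, circleMean] at key
    -- `B ≠ ⊤`
    have hBtop : B ≠ ⊤ := by
      intro hBt
      rw [← hB, hBt, EReal.coe_ennreal_top, EReal.sub_top] at key
      exact absurd (le_bot_iff.mp key) (EReal.coe_ne_bot x)
    -- pass to real numbers
    rw [← hA, ← hB, ← EReal.coe_ennreal_toReal hAtop, ← EReal.coe_ennreal_toReal hBtop,
      ← EReal.coe_sub, EReal.coe_le_coe_iff] at key
    rw [huc, ← EReal.coe_neg, EReal.real_coe_toENNReal, ← ENNReal.ofReal_toReal hAtop,
      ← ENNReal.ofReal_toReal hBtop]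
    calc ENNReal.ofReal B.toReal ≤ ENNReal.ofReal (A.toReal + (-x)) :=
          ENNReal.ofReal_le_ofReal (by linarith)
      _ ≤ ENNReal.ofReal A.toReal + ENNReal.ofReal (-x) := ENNReal.ofReal_add_le

/-- **The circle is integrable and the real mean-value inequality holds at a finite centre**: for
`u` subharmonic on `U ⊇ D̄(c, R)` with `u c ≠ -∞`, the real function `u.toReal` (junk `0` at the
poles of `u`) is integrable on the circle `|z - c| = R` and
`(u c).toReal ≤ (2π)⁻¹ ∫₀^{2π} (u (c + R e^{iθ})).toReal dθ` (poles on the circle only raise the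
right-hand side). [cite: HormanderSCV1973, Thm. 1.6.3] -/
theorem IsSubharmonicOn.circleIntegrable_toReal (hu : IsSubharmonicOn u U) (hR : 0 < R)
    (hcl : closedBall c R ⊆ U) (hc : u c ≠ ⊥) :
    CircleIntegrable (fun z ↦ (u z).toReal) c R ∧
      (u c).toReal ≤ Real.circleAverage (fun z ↦ (u z).toReal) c R := by
  have hU : ∀ θ : ℝ, circleMap c R θ ∈ U := fun θ ↦
    hcl (sphere_subset_closedBall (circleMap_mem_sphere c hR.le θ))
  obtain ⟨C, hC⟩ := exists_forall_comp_circleMap_le hu.upperSemicontinuousOn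
    (fun z hz ↦ hu.lt_top hz) hU
  have hAtop : circleUpperMean u c R ≠ ⊤ := circleUpperMean_ne_top hC
  have hBle := hu.circleLowerMean_le hR hcl
  have hBtop : circleLowerMean u c R ≠ ⊤ := by
    refine ne_top_of_le_ne_top ?_ hBle
    exact ENNReal.add_ne_top.mpr ⟨hAtop, by
      rcases EReal.eq_bot_or_eq_top_or_exists_coe (u c) with h | h | ⟨x, h⟩
      · exact absurd h hc
      · exact absurd h (hu.lt_top (hcl (mem_closedBall_self hR.le))).ne
      · rw [h, ← EReal.coe_neg, EReal.real_coe_toENNReal]; exact ENNReal.ofReal_ne_top⟩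
  have hmeas : Measurable fun θ : ℝ ↦ u (circleMap c R θ) :=
    measurable_comp_circleMap hu.upperSemicontinuousOn hU
  have hpi : ENNReal.ofReal (2 * Real.pi) ≠ 0 := by simp [Real.pi_pos]
  -- the two lower integrals are finite
  have hIA : ∫⁻ θ in Ioc (0 : ℝ) (2 * Real.pi), (u (circleMap c R θ)).toENNReal ≠ ⊤ := by
    intro h
    apply hAtop
    rw [circleUpperMean, h, ENNReal.top_div_of_ne_top ENNReal.ofReal_ne_top]
  have hIB : ∫⁻ θ in Ioc (0 : ℝ) (2 * Real.pi), (-u (circleMap c R θ)).toENNReal ≠ ⊤ := by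
    intro h
    apply hBtop
    rw [circleLowerMean, h, ENNReal.top_div_of_ne_top ENNReal.ofReal_ne_top]
  -- integrability on the circle
  have hint : CircleIntegrable (fun z ↦ (u z).toReal) c R := by
    rw [CircleIntegrable, intervalIntegrable_iff_integrableOn_Ioc_of_le Real.two_pi_pos.le]
    refine ⟨(hmeas.ereal_toReal).aestronglyMeasurable, ?_⟩
    refine lt_of_le_of_lt (lintegral_mono fun θ ↦ enorm_toReal_le _) ?_
    rw [lintegral_add_left (hmeas.ereal_toENNReal)]
    exact ENNReal.add_lt_top.mpr ⟨lt_top_iff_ne_top.mpr hIA, lt_top_iff_ne_top.mpr hIB⟩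
  refine ⟨hint, ?_⟩
  -- the inequality through `circleMean_mono`
  have hmono : circleMean u c R ≤ circleMean (fun z ↦ (((u z).toReal : ℝ) : EReal)) c R :=
    circleMean_mono fun θ _ ↦ EReal.le_coe_toReal (hu.lt_top (hU θ)).ne
  have key := (hu.le_circleMean hR hcl).trans hmono
  rw [circleMean_coe_eq_circleAverage _ c R hint] at key
  have : u c = (((u c).toReal : ℝ) : EReal) :=
    (EReal.coe_toReal (hu.lt_top (hcl (mem_closedBall_self hR.le))).ne hc).symm
  rw [this, EReal.coe_le_coe_iff] at key
  exact key


open Function in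
/-- Set lower integrals of a periodic function over period intervals do not depend on the
starting point. [folklore] -/
theorem lintegral_Ioc_eq_of_periodic {g : ℝ → ℝ≥0∞} {T : ℝ} (hg : Periodic g T) (hT : 0 < T)
    (s t : ℝ) : ∫⁻ x in Ioc s (s + T), g x = ∫⁻ x in Ioc t (t + T), g x := by
  haveI : Fact (0 < T) := ⟨hT⟩
  have h1 := AddCircle.lintegral_preimage T s hg.lift
  have h2 := AddCircle.lintegral_preimage T t hg.lift
  simp only [Periodic.lift_coe] at h1 h2
  rw [h1, h2]

/-- Polar coordinates and `circleMap`: `c + r e^{iθ} = circleMap c r θ`. [folklore] -/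
theorem add_polarCoord_symm_eq_circleMap (c : ℂ) (p : ℝ × ℝ) :
    c + Complex.polarCoord.symm p = circleMap c p.1 p.2 := by
  rw [Complex.polarCoord_symm_apply, circleMap, Complex.exp_mul_I]
  push_cast
  ring

variable {u : ℂ → EReal} {c : ℂ} {R : ℝ}

/-- The upper circle mean of a function bounded by `M` on the circle is at most `M⁺`. [folklore] -/
theorem circleUpperMean_le_of_le {M : ℝ} (hM : ∀ θ : ℝ, u (circleMap c R θ) ≤ M) :
    circleUpperMean u c R ≤ ENNReal.ofReal (max M 0) := by
  have hpi : ENNReal.ofReal (2 * Real.pi) ≠ 0 := by simp [Real.pi_pos]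
  rw [circleUpperMean, ENNReal.div_le_iff hpi ENNReal.ofReal_ne_top]
  calc ∫⁻ θ in Ioc (0 : ℝ) (2 * Real.pi), (u (circleMap c R θ)).toENNReal
      ≤ ∫⁻ _ in Ioc (0 : ℝ) (2 * Real.pi), ENNReal.ofReal (max M 0) := by
        refine lintegral_mono fun θ ↦ ?_
        calc (u (circleMap c R θ)).toENNReal ≤ ((M : ℝ) : EReal).toENNReal :=
              EReal.toENNReal_le_toENNReal (hM θ)
          _ = ENNReal.ofReal M := EReal.real_coe_toENNReal M
          _ ≤ ENNReal.ofReal (max M 0) := ENNReal.ofReal_le_ofReal (le_max_left _ _)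
    _ = ENNReal.ofReal (max M 0) * ENNReal.ofReal (2 * Real.pi) := by
        rw [setLIntegral_const, Real.volume_Ioc, sub_zero, mul_comm]

/-- **The solid mean-value inequality, `[0, ∞]` form**: for `u` subharmonic on `ℂ` with `u ≤ M`
on the closed disc `D̄(c, R)`, `∫_{D̄(c,R)} u⁻ dλ ≤ (M⁺ + (u c)⁻) · λ(D̄(c, R))` (integrate the
circle inequality `circleLowerMean_le` over the radii in polar coordinates). In particular
`u ∈ L¹(D̄(c, R))` as soon as `u c ≠ -∞`. [cite: HormanderSCV1973, Thm. 1.6.3] -/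
theorem IsSubharmonicOn.lintegral_closedBall_negPart_le (hu : IsSubharmonicOn u univ)
    (hR : 0 < R) {M : ℝ} (hM : ∀ z ∈ closedBall c R, u z ≤ M) :
    ∫⁻ z in closedBall c R, (-u z).toENNReal ≤
      (ENNReal.ofReal (max M 0) + (-u c).toENNReal) * volume (closedBall c R) := by
  set K : ℝ≥0∞ := ENNReal.ofReal (max M 0) + (-u c).toENNReal with hK
  have husc : UpperSemicontinuous u := upperSemicontinuousOn_univ_iff.mp hu.upperSemicontinuousOn
  have hmeas : Measurable u := husc.measurable
  set h : ℂ → ℝ≥0∞ := fun z ↦ (-u (c + z)).toENNReal with hh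
  have hhm : Measurable h := ((hmeas.comp (continuous_const.add
      continuous_id).measurable).neg).ereal_toENNReal
  -- translate to the origin
  have htrans : ∫⁻ z in closedBall c R, (-u z).toENNReal = ∫⁻ z in closedBall 0 R, h z := by
    rw [← lintegral_indicator measurableSet_closedBall,
        ← lintegral_indicator measurableSet_closedBall,
      ← lintegral_add_left_eq_self ((closedBall c R).indicator fun z ↦ (-u z).toENNReal) c]
    congr 1
    funext z
    simp only [Set.indicator, mem_closedBall, dist_eq_norm, add_sub_cancel_left, sub_zero, hh]
  -- polar coordinates
  have hpolar : ∫⁻ z in closedBall (0 : ℂ) R, h z =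
      ∫⁻ p in Ioi (0 : ℝ) ×ˢ Ioo (-Real.pi) Real.pi,
        ENNReal.ofReal p.1 * (Ioc 0 R).indicator (fun _ ↦ (1 : ℝ≥0∞)) p.1 *
          (-u (circleMap c p.1 p.2)).toENNReal := by
    rw [← lintegral_indicator measurableSet_closedBall, ← Complex.lintegral_comp_polarCoord_symm,
      show polarCoord.target = Ioi (0 : ℝ) ×ˢ Ioo (-Real.pi) Real.pi from rfl]
    refine setLIntegral_congr_fun (measurableSet_Ioi.prod measurableSet_Ioo) fun p hp ↦ ?_
    have hr : 0 < p.1 := hp.1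
    simp only [Set.indicator, mem_closedBall, dist_zero_right, Complex.norm_polarCoord_symm,
      abs_of_pos hr, mem_Ioc, hr, true_and, hh, add_polarCoord_symm_eq_circleMap, smul_eq_mul]
    split_ifs <;> simp
  -- the angular integrals
  have hpi0 : ENNReal.ofReal (2 * Real.pi) ≠ 0 := by simp [Real.pi_pos]
  have hang : ∀ r ∈ Ioc 0 R, ∫⁻ θ in Ioo (-Real.pi) Real.pi, (-u (circleMap c r θ)).toENNReal ≤
      K * ENNReal.ofReal (2 * Real.pi) := by
    intro r hr
    have hper : Function.Periodic (fun θ : ℝ ↦ (-u (circleMap c r θ)).toENNReal)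
        (2 * Real.pi) := fun θ ↦ by simp only [periodic_circleMap c r θ]
    have hshift := lintegral_Ioc_eq_of_periodic hper Real.two_pi_pos (-Real.pi) 0
    rw [show -Real.pi + 2 * Real.pi = Real.pi by ring, zero_add] at hshift
    rw [Measure.restrict_congr_set Ioo_ae_eq_Ioc, hshift]
    have hlow : ∫⁻ θ in Ioc 0 (2 * Real.pi), (-u (circleMap c r θ)).toENNReal =
        circleLowerMean u c r * ENNReal.ofReal (2 * Real.pi) := by
      rw [circleLowerMean, ENNReal.div_mul_cancel hpi0 ENNReal.ofReal_ne_top]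
    rw [hlow]
    gcongr
    calc circleLowerMean u c r ≤ circleUpperMean u c r + (-u c).toENNReal :=
          hu.circleLowerMean_le hr.1 (subset_univ _)
      _ ≤ ENNReal.ofReal (max M 0) + (-u c).toENNReal := by
          gcongr
          refine circleUpperMean_le_of_le fun θ ↦ hM _ ?_
          rw [mem_closedBall, dist_eq_norm, circleMap_sub_center, norm_circleMap_zero,
            abs_of_pos hr.1]
          exact hr.2
  -- Tonelli
  have hgm : Measurable fun p : ℝ × ℝ ↦ (-u (circleMap c p.1 p.2)).toENNReal :=
    ((hmeas.comp (by fun_prop : Continuous fun p : ℝ × ℝ ↦ circleMap c p.1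
        p.2).measurable).neg).ereal_toENNReal
  have hFm : Measurable fun p : ℝ × ℝ ↦
      ENNReal.ofReal p.1 * (Ioc 0 R).indicator (fun _ ↦ (1 : ℝ≥0∞)) p.1 *
        (-u (circleMap c p.1 p.2)).toENNReal :=
    ((ENNReal.measurable_ofReal.comp measurable_fst).mul
      ((measurable_const.indicator measurableSet_Ioc).comp measurable_fst)).mul hgm
  rw [htrans, hpolar, Measure.volume_eq_prod, ← Measure.prod_restrict,
    lintegral_prod _ hFm.aemeasurable]
  calc ∫⁻ r in Ioi (0 : ℝ), ∫⁻ θ in Ioo (-Real.pi) Real.pi,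
        ENNReal.ofReal r * (Ioc 0 R).indicator (fun _ ↦ (1 : ℝ≥0∞)) r *
          (-u (circleMap c r θ)).toENNReal
      ≤ ∫⁻ r in Ioi (0 : ℝ), ENNReal.ofReal r * (Ioc 0 R).indicator (fun _ ↦ (1 : ℝ≥0∞)) r *
          (K * ENNReal.ofReal (2 * Real.pi)) := by
        refine setLIntegral_mono' measurableSet_Ioi fun r hr ↦ ?_
        have hθm : Measurable fun θ : ℝ ↦ (-u (circleMap c r θ)).toENNReal :=
          ((hmeas.comp (continuous_circleMap c r).measurable).neg).ereal_toENNReal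
        rw [lintegral_const_mul _ hθm]
        by_cases hrR : r ∈ Ioc 0 R
        · gcongr
          exact hang r hrR
        · simp [Set.indicator_of_notMem hrR]
    _ = K * ENNReal.ofReal (2 * Real.pi) * ∫⁻ r in Ioc (0 : ℝ) R, ENNReal.ofReal r := by
        rw [lintegral_mul_const _ (show Measurable (fun r : ℝ ↦ ENNReal.ofReal r *
          (Ioc 0 R).indicator (fun _ ↦ (1 : ℝ≥0∞)) r) from
            ENNReal.measurable_ofReal.mul (measurable_const.indicator measurableSet_Ioc)), mul_comm]
        congr 1
        have hind : (fun r : ℝ ↦ ENNReal.ofReal r * (Ioc 0 R).indicator (fun _ ↦ (1 : ℝ≥0∞)) r) =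
            (Ioc 0 R).indicator fun r ↦ ENNReal.ofReal r := by
          funext r
          by_cases hr : r ∈ Ioc 0 R
          · simp [Set.indicator_of_mem hr]
          · simp [Set.indicator_of_notMem hr]
        rw [hind, setLIntegral_indicator measurableSet_Ioc,
          Set.inter_eq_left.mpr Ioc_subset_Ioi_self]
    _ = K * volume (closedBall c R) := by
        have hint : ∫⁻ r in Ioc (0 : ℝ) R, ENNReal.ofReal r = ENNReal.ofReal (R ^ 2 / 2) := by
          have hio : IntegrableOn (fun x : ℝ ↦ x) (Ioc 0 R) :=
            (intervalIntegrable_iff_integrableOn_Ioc_of_le hR.le).mp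
              (continuous_id.intervalIntegrable 0 R)
          rw [← ofReal_integral_eq_lintegral_ofReal hio
            ((ae_restrict_iff' measurableSet_Ioc).2 (ae_of_all _ fun r hr ↦ hr.1.le)),
            ← intervalIntegral.integral_of_le hR.le, integral_id]
          simp
        rw [hint, Complex.volume_closedBall, mul_assoc]
        congr 1
        rw [← ENNReal.ofReal_mul (by positivity), ← ENNReal.ofReal_coe_nnreal, NNReal.coe_real_pi,
          ← ENNReal.ofReal_pow hR.le, ← ENNReal.ofReal_mul (by positivity)]
        congr 1
        ring


/-! ### Plurisubharmonic functions on `ℂᵐ`: slices and the polydisc inequality -/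

section Polydisc

/-- `Fin.cons a z' + τ • Fin.cons 0 w' = Fin.cons a (z' + τ • w')`. [folklore] -/
theorem cons_add_smul_cons_zero {m : ℕ} (a : ℂ) (z' w' : Fin m → ℂ) (τ : ℂ) :
    (Fin.cons a z' : Fin (m + 1) → ℂ) + τ • (Fin.cons 0 w' : Fin (m + 1) → ℂ) =
      Fin.cons a (z' + τ • w') := by
  ext i
  refine Fin.cases ?_ (fun j ↦ ?_) i <;> simp

/-- `Fin.cons 0 z' + τ • Fin.cons 1 0 = Fin.cons τ z'`. [folklore] -/
theorem cons_zero_add_smul_cons_one {m : ℕ} (z' : Fin m → ℂ) (τ : ℂ) :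
    (Fin.cons 0 z' : Fin (m + 1) → ℂ) + τ • (Fin.cons 1 0 : Fin (m + 1) → ℂ) = Fin.cons τ z' := by
  ext i
  refine Fin.cases ?_ (fun j ↦ ?_) i <;> simp

variable {m : ℕ}

/-- Slices of a plurisubharmonic function on `ℂ^{m+1}` in the last `m` variables are
plurisubharmonic. [cite: HormanderSCV1973, Def. 2.6.1] -/
theorem IsPlurisubharmonicOn.slice_cons {u : (Fin (m + 1) → ℂ) → EReal}
    (hu : IsPlurisubharmonicOn u univ) (a : ℂ) :
    IsPlurisubharmonicOn (fun z' : Fin m → ℂ ↦ u (Fin.cons a z')) univ := by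
  have hcont : Continuous fun z' : Fin m → ℂ ↦ (Fin.cons a z' : Fin (m + 1) → ℂ) := by
    refine continuous_pi fun i ↦ ?_
    refine Fin.cases ?_ (fun j ↦ ?_) i
    · simpa using continuous_const
    · simpa using continuous_apply j
  refine ⟨?_, fun z' _ ↦ hu.lt_top (mem_univ _), fun z' w' ↦ ?_⟩
  · exact hu.upperSemicontinuousOn.comp hcont.continuousOn fun _ _ ↦ mem_univ _
  · have h := hu.isSubharmonicOn_line (Fin.cons a z') (Fin.cons 0 w')
    simp only [cons_add_smul_cons_zero, mem_univ, setOf_true] at h ⊢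
    exact h

/-- The restriction of a plurisubharmonic function on `ℂ^{m+1}` to the first coordinate line
through `(·, z')` is subharmonic. [cite: HormanderSCV1973, Def. 2.6.1] -/
theorem IsPlurisubharmonicOn.slice_first {u : (Fin (m + 1) → ℂ) → EReal}
    (hu : IsPlurisubharmonicOn u univ) (z' : Fin m → ℂ) :
    IsSubharmonicOn (fun τ : ℂ ↦ u (Fin.cons τ z')) univ := by
  have h := hu.isSubharmonicOn_line (Fin.cons 0 z') (Fin.cons 1 0)
  simp only [cons_zero_add_smul_cons_one, mem_univ, setOf_true] at h
  exact h

/-- A plurisubharmonic function on `ℂᵐ` is (Borel) measurable. [folklore] -/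
theorem IsPlurisubharmonicOn.measurable_of_univ {u : (Fin m → ℂ) → EReal}
    (hu : IsPlurisubharmonicOn u univ) : Measurable u :=
  (upperSemicontinuousOn_univ_iff.mp hu.upperSemicontinuousOn).measurable

/-- Sup-norm balls of `ℂ^{m+1}` split as products under `piFinSuccAbove`. [folklore] -/
theorem piFinSuccAbove_symm_mem_closedBall {z₀ : Fin (m + 1) → ℂ} {ρ : ℝ} (hρ : 0 ≤ ρ)
    (p : ℂ × (Fin m → ℂ)) :
    (MeasurableEquiv.piFinSuccAbove (fun _ : Fin (m + 1) ↦ ℂ) 0).symm p ∈ closedBall z₀ ρ ↔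
      p.1 ∈ closedBall (z₀ 0) ρ ∧ p.2 ∈ closedBall (fun j ↦ z₀ j.succ) ρ := by
  simp only [mem_closedBall, dist_pi_le_iff hρ, MeasurableEquiv.piFinSuccAbove_symm_apply,
    Fin.forall_fin_succ, Fin.insertNthEquiv, Equiv.coe_fn_mk]
  simp [Fin.insertNth_zero']


/-- **The polydisc mean-value inequality for plurisubharmonic functions, `[0, ∞]` form**: for `u`
plurisubharmonic on `ℂᵐ` with `u ≤ M` on the closed sup-norm ball (polydisc) `P̄(z₀, ρ)`,
`∫_{P̄(z₀,ρ)} u⁻ dλ ≤ (m M⁺ + (u z₀)⁻) · λ(P̄(z₀, ρ))` — by induction on `m`: slice off the first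
variable (Tonelli through `piFinSuccAbove`), apply the induction hypothesis to the slices
`u(a, ·)` and the planar inequality `lintegral_closedBall_negPart_le` to `u(·, z₀')`.
In particular `u ∈ L¹_{loc}` when `u z₀ ≠ -∞` at one point. [cite: HormanderSCV1973, Thm. 1.6.3 and §2.6] -/
theorem IsPlurisubharmonicOn.lintegral_closedBall_negPart_le_pi :
    ∀ (m : ℕ) (u : (Fin m → ℂ) → EReal), IsPlurisubharmonicOn u univ →
      ∀ (z₀ : Fin m → ℂ) {ρ : ℝ}, 0 < ρ → ∀ {M : ℝ}, (∀ z ∈ closedBall z₀ ρ, u z ≤ M) →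
        ∫⁻ z in closedBall z₀ ρ, (-u z).toENNReal ≤
          (m * ENNReal.ofReal (max M 0) + (-u z₀).toENNReal) * volume (closedBall z₀ ρ) := by
  intro m
  induction m with
  | zero =>
    intro u hu z₀ ρ hρ M hM
    have hsub : ∀ z : Fin 0 → ℂ, z = z₀ := fun z ↦ Subsingleton.elim _ _
    have hconst : (fun z : Fin 0 → ℂ ↦ (-u z).toENNReal) = fun _ ↦ (-u z₀).toENNReal := by
      funext z; rw [hsub z]
    rw [hconst, setLIntegral_const]
    simp
  | succ m ih =>
    intro u hu z₀ ρ hρ M hM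
    set e := MeasurableEquiv.piFinSuccAbove (fun _ : Fin (m + 1) ↦ ℂ) 0 with he
    have hmp : MeasurePreserving e.symm := (volume_preserving_piFinSuccAbove (fun _ : Fin (m + 1)
        ↦ ℂ) 0).symm
    set z₀' : Fin m → ℂ := fun j ↦ z₀ j.succ with hz₀'
    set D := closedBall (z₀ 0) ρ with hD
    set B := closedBall z₀' ρ with hB
    have hmeas : Measurable u := hu.measurable_of_univ
    -- the integrand and the set in product coordinates
    set f : (Fin (m + 1) → ℂ) → ℝ≥0∞ := fun z ↦ (-u z).toENNReal with hf
    have hfm : Measurable f := hmeas.neg.ereal_toENNReal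
    have hsymm : ∀ p : ℂ × (Fin m → ℂ), e.symm p = Fin.cons p.1 p.2 := fun p ↦ by
      simp [he, MeasurableEquiv.piFinSuccAbove_symm_apply, Fin.insertNthEquiv, Fin.insertNth_zero']
    have hset : e.symm ⁻¹' closedBall z₀ ρ = D ×ˢ B := by
      ext p
      simp only [mem_preimage, mem_prod, he, piFinSuccAbove_symm_mem_closedBall hρ.le, hD, hB, hz₀']
    -- change of variables and Tonelli
    have hcov : ∫⁻ z in closedBall z₀ ρ, f z = ∫⁻ p in D ×ˢ B, f (Fin.cons p.1 p.2) := by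
      rw [← lintegral_indicator measurableSet_closedBall,
        ← hmp.lintegral_comp (hfm.indicator measurableSet_closedBall),
        ← lintegral_indicator (measurableSet_closedBall.prod measurableSet_closedBall)]
      congr 1
      funext p
      have hiff : p ∈ D ×ˢ B ↔ e.symm p ∈ closedBall z₀ ρ := by rw [← mem_preimage, hset]
      by_cases hp : e.symm p ∈ closedBall z₀ ρ
      · rw [indicator_of_mem hp, indicator_of_mem (hiff.mpr hp), hsymm]
      · rw [indicator_of_notMem hp, indicator_of_notMem (fun h ↦ hp (hiff.mp h))]
    have hcons : Continuous fun p : ℂ × (Fin m → ℂ) ↦ (Fin.cons p.1 p.2 : Fin (m + 1) → ℂ) := by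
      refine continuous_pi fun i ↦ Fin.cases ?_ (fun j ↦ ?_) i
      · simp only [Fin.cons_zero]; exact continuous_fst
      · simp only [Fin.cons_succ]; exact (continuous_apply j).comp continuous_snd
    have hFm : Measurable fun p : ℂ × (Fin m → ℂ) ↦ f (Fin.cons p.1 p.2) :=
      hfm.comp hcons.measurable
    rw [hcov, Measure.volume_eq_prod, ← Measure.prod_restrict, lintegral_prod _ hFm.aemeasurable]
    -- the slices
    have hslice : ∀ a ∈ D, ∫⁻ z' in B, f (Fin.cons a z') ≤
        (m * ENNReal.ofReal (max M 0) + (-u (Fin.cons a z₀')).toENNReal) * volume B := by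
      intro a ha
      refine ih (fun z' ↦ u (Fin.cons a z')) (hu.slice_cons a) z₀' hρ fun z' hz' ↦ hM _ ?_
      have := (piFinSuccAbove_symm_mem_closedBall (z₀ := z₀) hρ.le (a, z')).mpr ⟨ha, hz'⟩
      rwa [hsymm] at this
    -- the first-coordinate line through `z₀`
    have hline : ∫⁻ a in D, (-u (Fin.cons a z₀')).toENNReal ≤
        (ENNReal.ofReal (max M 0) + (-u z₀).toENNReal) * volume D := by
      have h1 := (hu.slice_first z₀').lintegral_closedBall_negPart_le (c := z₀ 0) hρ
        (M := M) fun a ha ↦ hM _ ?_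
      · have hz : (Fin.cons (z₀ 0) z₀' : Fin (m + 1) → ℂ) = z₀ := by
          rw [hz₀']; exact Fin.cons_self_tail z₀
        rw [hz] at h1
        exact h1
      · have := (piFinSuccAbove_symm_mem_closedBall (z₀ := z₀) hρ.le (a, z₀')).mpr
          ⟨ha, mem_closedBall_self hρ.le⟩
        rwa [hsymm] at this
    -- assemble
    have hvol : volume (closedBall z₀ ρ) = volume D * volume B := by
      rw [← hmp.measure_preimage (measurableSet_closedBall (x := z₀) (ε := ρ)).nullMeasurableSet,
          hset,
        Measure.volume_eq_prod, Measure.prod_prod]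
    have hgm : Measurable fun a : ℂ ↦ (-u (Fin.cons a z₀')).toENNReal := by
      have hc : Continuous fun a : ℂ ↦ (Fin.cons a z₀' : Fin (m + 1) → ℂ) := by
        refine continuous_pi fun i ↦ Fin.cases ?_ (fun j ↦ ?_) i
        · simp only [Fin.cons_zero]; exact continuous_id
        · simp only [Fin.cons_succ]; exact continuous_const
      exact (hmeas.comp hc.measurable).neg.ereal_toENNReal
    calc ∫⁻ a in D, ∫⁻ z' in B, f (Fin.cons a z')
        ≤ ∫⁻ a in D, ((m * ENNReal.ofReal (max M 0)) * volume B +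
            (-u (Fin.cons a z₀')).toENNReal * volume B) := by
          refine setLIntegral_mono' measurableSet_closedBall fun a ha ↦ ?_
          rw [← add_mul]
          exact hslice a ha
      _ = (m * ENNReal.ofReal (max M 0)) * volume B * volume D +
            (∫⁻ a in D, (-u (Fin.cons a z₀')).toENNReal) * volume B := by
          rw [lintegral_add_left measurable_const, setLIntegral_const, lintegral_mul_const _ hgm]
      _ ≤ (m * ENNReal.ofReal (max M 0)) * volume B * volume D +
            ((ENNReal.ofReal (max M 0) + (-u z₀).toENNReal) * volume D) * volume B := by
          gcongr
      _ = ((m + 1 : ℕ) * ENNReal.ofReal (max M 0) + (-u z₀).toENNReal) *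
            volume (closedBall z₀ ρ) := by
          rw [hvol]; push_cast; ring

end Polydisc


end Literature.Analysis.Pluripotential

end
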